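import Literature.NumberTheory.Automorphic.SchwartzBruhatCosetIndicator
import HarnessLib

/-!
# Finite sums of thin-coset test functions `Σ_t φ_t ⊗ 𝟙_{t + (𝔫𝒪̂_K)^ι}` in `𝒮(𝔸_K^ι)`

Topic `NumberTheory/Automorphic`; namespace `Literature.NumberTheory.Automorphic`. For a number field
`K` and a finite index type `ι`, kernel glue (theorems only, everything proved, no named fact) about
the Schwartz–Bruhat space `piSchwartzBruhat K ι` of `𝔸_K^ι` (`AdelicPiSchwartzBruhatFourier`: the
span of the pure tensors `Φ_∞ ⊗ Φ_f`, `Φ_∞` Schwartz on `(K ⊗ ℝ)^ι`, `Φ_f` locally constant of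
compact support on `(𝔸_K^∞)^ι`), used to build cutoffs (`AdelicSchwartzBruhatCutoff`) and to prove
the uniform density of `𝒮(𝔸_K^ι)` in `C_c(𝔸_K^ι)` (`AdelicSchwartzBruhatDensity`) — Weil's
"standard functions" (Weil 1965, n° 2; Weil, *Basic Number Theory*, VII §2; Tate's thesis, §3.2):

* §1 `exists_ball_prod_coset_subset` — a **product Lebesgue-number lemma** on
  `(K ⊗ ℝ)^ι × (𝔸_K^∞)^ι`: for a compact `S` and neighbourhoods `W p` of its points there are ONE
  radius `r > 0` and ONE non-zero ideal `𝔫` such that every box `ball(a, r) × (b + (𝔫𝒪̂_K)^ι)` at a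
  point `(a, b) ∈ S` lies in some `W p₀` (`exists_piLevelIdeal_subset`: level boxes are cofinal).
* §2 `exists_finset_repr_cover` — finitely many pairwise inequivalent coset representatives of an
  open subgroup covering a compact set (any topological additive group).
* §3 `sum_thinCosetTestFun_mem_piSchwartzBruhat`, `sum_thinCosetTestFun_apply_of_mem`,
  `sum_thinCosetTestFun_apply_of_forall_not_mem`, `tsupport_sum_thinCosetTestFun_subset`,
  `hasCompactSupport_sum_thinCosetTestFun`, `isCompact_archFinBox` / `isClosed_archFinBox` — the
  finite sums `Σ_t φ_t ⊗ 𝟙_{t + (𝔫𝒪̂_K)^ι}` of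
  `thinCosetTestFun`s: membership in `𝒮(𝔸_K^ι)`, values on / off the cosets, support.

## References
* A. Weil, *Sur certains groupes d'opérateurs unitaires*, Acta Math. 111 (1964), n° 11 p. 158
  (the spaces `𝒮(H, H')`: support in an open subgroup `H`, constant on the cosets of a compact
  subgroup `H'`, Schwartz on `H/H'`) [Weil1964].
* A. Weil, *Sur la formule de Siegel dans la théorie des groupes classiques*, Acta Math. 113 (1965),
  n° 2 [Weil1965].
* A. Weil, *Basic Number Theory* (1967), Ch. VII §2 [WeilBNT1967].
* J. Tate, *Fourier analysis in number fields*, in Cassels–Fröhlich (1967), Ch. XV §3.2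
  [CasselsFrohlichANT1967].
-/

noncomputable section

open Set Metric NumberField NumberField.InfinitePlace NumberField.mixedEmbedding IsDedekindDomain
open scoped Pointwise SchwartzMap Classical Topology

namespace Literature.NumberTheory.Automorphic

/-! ## 1. A product Lebesgue-number lemma on `(K ⊗ ℝ)^ι × (𝔸_K^∞)^ι` -/

section Lebesgue

variable (K : Type) [Field K] [NumberField K] (ι : Type) [Fintype ι]

/-- A neighbourhood of `(a, b)` in `(K ⊗ ℝ)^ι × (𝔸_K^∞)^ι` contains a box `ball(a, 2r) × (b + (𝔫𝒪̂_K)^ι)`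
with `r > 0` and `𝔫 ≠ 0` (metric balls and the cofinal level boxes `exists_piLevelIdeal_subset`).
[cite: Weil1964, n° 11 p. 158] -/
theorem exists_ball_prod_coset_subset_of_mem_nhds
    {p : (ι → mixedSpace K) × (ι → FiniteAdeleRing (𝓞 K) K)}
    {W : Set ((ι → mixedSpace K) × (ι → FiniteAdeleRing (𝓞 K) K))} (hW : W ∈ 𝓝 p) :
    ∃ r : ℝ, 0 < r ∧ ∃ 𝔫 : Ideal (𝓞 K), 𝔫 ≠ 0 ∧
      ball p.1 (2 * r) ×ˢ (p.2 +ᵥ (piLevelIdeal K ι 𝔫 : Set (ι → FiniteAdeleRing (𝓞 K) K))) ⊆ W := by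
  obtain ⟨u, hu, v, hv, huv⟩ := mem_nhds_prod_iff.1 hW
  obtain ⟨r', hr', hball⟩ := Metric.mem_nhds_iff.1 hu
  have hv0 : (fun l => p.2 + l) ⁻¹' v ∈ 𝓝 (0 : ι → FiniteAdeleRing (𝓞 K) K) := by
    refine (continuous_const.add continuous_id).continuousAt.preimage_mem_nhds ?_
    simpa using hv
  obtain ⟨𝔫, h𝔫, hsub⟩ := exists_piLevelIdeal_subset K hv0
  refine ⟨r' / 2, by positivity, 𝔫, h𝔫, ?_⟩
  rintro ⟨x, y⟩ ⟨hx, hy⟩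
  refine huv ⟨hball (by simpa [mul_div_cancel₀] using hx), ?_⟩
  obtain ⟨l, hl, rfl⟩ := Set.mem_vadd_set.1 hy
  exact hsub hl

/-- **Product Lebesgue-number lemma.** For a compact `S ⊆ (K ⊗ ℝ)^ι × (𝔸_K^∞)^ι` and a neighbourhood
`W p` of every `p ∈ S` there are ONE radius `r > 0` and ONE non-zero ideal `𝔫` such that for every
`(a, b) ∈ S` the box `ball(a, r) × (b + (𝔫𝒪̂_K)^ι)` lies in `W p₀` for some `p₀ ∈ S` (finite
subcover by half-size boxes; `𝔫 :=` the product of the finitely many ideals). [cite: Weil1964, n° 11 p. 158] -/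
theorem exists_ball_prod_coset_subset
    {S : Set ((ι → mixedSpace K) × (ι → FiniteAdeleRing (𝓞 K) K))} (hS : IsCompact S)
    {W : (ι → mixedSpace K) × (ι → FiniteAdeleRing (𝓞 K) K) →
      Set ((ι → mixedSpace K) × (ι → FiniteAdeleRing (𝓞 K) K))}
    (hW : ∀ p ∈ S, W p ∈ 𝓝 p) :
    ∃ r : ℝ, 0 < r ∧ ∃ 𝔫 : Ideal (𝓞 K), 𝔫 ≠ 0 ∧ ∀ p ∈ S, ∃ p₀ ∈ S,
      ball p.1 r ×ˢ (p.2 +ᵥ (piLevelIdeal K ι 𝔫 : Set (ι → FiniteAdeleRing (𝓞 K) K))) ⊆ W p₀ := by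
  -- a box at every point of `S`
  have h1 : ∀ p : S, ∃ r : ℝ, 0 < r ∧ ∃ 𝔫 : Ideal (𝓞 K), 𝔫 ≠ 0 ∧
      ball p.1.1 (2 * r) ×ˢ (p.1.2 +ᵥ (piLevelIdeal K ι 𝔫 : Set (ι → FiniteAdeleRing (𝓞 K) K))) ⊆
        W p.1 :=
    fun p => exists_ball_prod_coset_subset_of_mem_nhds K ι (hW p.1 p.2)
  choose r hr 𝔫 h𝔫 hsub using h1
  -- the half-size boxes cover `S`
  set O : S → Set ((ι → mixedSpace K) × (ι → FiniteAdeleRing (𝓞 K) K)) := fun p =>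
    ball p.1.1 (r p) ×ˢ (p.1.2 +ᵥ (piLevelIdeal K ι (𝔫 p) : Set (ι → FiniteAdeleRing (𝓞 K) K)))
    with hO
  have hOo : ∀ p, IsOpen (O p) := fun p =>
    isOpen_ball.prod ((isOpen_piLevelIdeal K (𝔫 p)).vadd _)
  have hcover : S ⊆ ⋃ p, O p := fun p hp =>
    Set.mem_iUnion.2 ⟨⟨p, hp⟩, mem_ball_self (hr _), ⟨0, zero_mem _, by simp⟩⟩
  obtain ⟨T, hT⟩ := hS.elim_finite_subcover O hOo hcover
  rcases S.eq_empty_or_nonempty with hSe | ⟨s, hs⟩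
  · exact ⟨1, one_pos, ⊤, by simp, fun p hp => by simp [hSe] at hp⟩
  have hTne : T.Nonempty := by
    obtain ⟨p, hpT, -⟩ := Set.mem_iUnion₂.1 (hT hs)
    exact ⟨p, hpT⟩
  -- one radius and one level
  set r₀ : ℝ := T.inf' hTne r with hr₀
  have hr₀pos : 0 < r₀ := (Finset.lt_inf'_iff hTne).2 fun p _ => hr p
  have hr₀le : ∀ p ∈ T, r₀ ≤ r p := fun p hp => Finset.inf'_le _ hp
  have hprod : (∏ p ∈ T, 𝔫 p) ≠ 0 := Finset.prod_ne_zero_iff.2 fun p _ => h𝔫 p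
  have hle : ∀ p ∈ T, piLevelIdeal K ι (∏ q ∈ T, 𝔫 q) ≤ piLevelIdeal K ι (𝔫 p) := fun p hp =>
    piLevelIdeal_mono K hprod (Ideal.prod_le_inf.trans (Finset.inf_le hp))
  refine ⟨r₀, hr₀pos, ∏ p ∈ T, 𝔫 p, hprod, fun p hp => ?_⟩
  obtain ⟨p₀, hp₀T, hp₀⟩ := Set.mem_iUnion₂.1 (hT hp)
  refine ⟨p₀.1, p₀.2, Set.Subset.trans ?_ (hsub p₀)⟩
  obtain ⟨hpa, hpb⟩ := hp₀
  obtain ⟨l₀, hl₀, hl₀eq⟩ := Set.mem_vadd_set.1 hpb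
  rintro ⟨x, y⟩ ⟨hx, hy⟩
  refine ⟨?_, ?_⟩
  · -- `dist x p₀.1 < r₀ + r p₀ ≤ 2 r p₀`
    have h1 : dist x p₀.1.1 ≤ dist x p.1 + dist p.1 p₀.1.1 := dist_triangle _ _ _
    rw [mem_ball] at hx hpa ⊢
    linarith [hr₀le p₀ hp₀T]
  · obtain ⟨l, hl, rfl⟩ := Set.mem_vadd_set.1 hy
    refine Set.mem_vadd_set.2 ⟨l₀ + l, add_mem hl₀ (hle p₀ hp₀T hl), ?_⟩
    rw [← hl₀eq, vadd_eq_add, vadd_eq_add, vadd_eq_add, add_assoc]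

end Lebesgue

/-! ## 2. Finitely many pairwise inequivalent coset representatives covering a compact set -/

section Representatives

variable {A : Type*} [AddCommGroup A] [TopologicalSpace A] [IsTopologicalAddGroup A]

/-- For an open subgroup `L` of a topological additive group and a compact `S`, finitely many
PAIRWISE INEQUIVALENT representatives `t ∈ T` whose cosets `t + L` cover `S` (finite subcover by
cosets, then one representative per class in `A ⧸ L`). [cite: Weil1964, n° 11 p. 158] -/
theorem exists_finset_repr_cover (L : AddSubgroup A) (hL : IsOpen (L : Set A)) {S : Set A}
    (hS : IsCompact S) :
    ∃ T : Finset A, (∀ t ∈ T, ∀ t' ∈ T, t ≠ t' → -t + t' ∉ L) ∧ S ⊆ ⋃ t ∈ T, (t +ᵥ (L : Set A)) := by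
  obtain ⟨B, hB⟩ := hS.elim_finite_subcover (fun b : A => b +ᵥ (L : Set A)) (fun b => hL.vadd b)
    (fun b _ => Set.mem_iUnion.2 ⟨b, ⟨0, zero_mem _, by simp⟩⟩)
  refine ⟨(B.image (QuotientAddGroup.mk (s := L))).image Quotient.out, ?_, ?_⟩
  · intro t ht t' ht' hne hmem
    obtain ⟨q, -, rfl⟩ := Finset.mem_image.1 ht
    obtain ⟨q', -, rfl⟩ := Finset.mem_image.1 ht'
    have hq : (QuotientAddGroup.mk q.out : A ⧸ L) = QuotientAddGroup.mk q'.out :=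
      QuotientAddGroup.eq.2 hmem
    rw [QuotientAddGroup.out_eq', QuotientAddGroup.out_eq'] at hq
    exact hne (by rw [hq])
  · intro x hx
    obtain ⟨b, hbB, hxb⟩ := Set.mem_iUnion₂.1 (hB hx)
    obtain ⟨l, hl, rfl⟩ := Set.mem_vadd_set.1 hxb
    refine Set.mem_iUnion₂.2 ⟨(QuotientAddGroup.mk b : A ⧸ L).out,
      Finset.mem_image.2 ⟨_, Finset.mem_image.2 ⟨b, hbB, rfl⟩, rfl⟩, ?_⟩
    have hb : -(QuotientAddGroup.mk b : A ⧸ L).out + b ∈ L := by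
      rw [← QuotientAddGroup.eq, QuotientAddGroup.out_eq']
    refine Set.mem_vadd_set.2 ⟨-(QuotientAddGroup.mk b : A ⧸ L).out + b + l, add_mem hb hl, ?_⟩
    simp only [vadd_eq_add]
    abel

end Representatives

/-! ## 3. Finite sums of thin-coset test functions `Σ_t φ_t ⊗ 𝟙_{t + (𝔫𝒪̂_K)^ι}` -/

section Sums

variable (K : Type) [Field K] [NumberField K] (ι : Type) [Fintype ι]

/-- A finite sum of thin-coset test functions lies in `𝒮(𝔸_K^ι)`. [cite: Weil1964, n° 11 p. 158] -/
theorem sum_thinCosetTestFun_mem_piSchwartzBruhat (T : Finset (ι → FiniteAdeleRing (𝓞 K) K))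
    (φ : (ι → FiniteAdeleRing (𝓞 K) K) → 𝓢((ι → mixedSpace K), ℂ)) (𝔫 : Ideal (𝓞 K)) :
    (fun v => ∑ t ∈ T, thinCosetTestFun K ι (φ t) t 𝔫 v) ∈ piSchwartzBruhat K ι := by
  have h : (fun v => ∑ t ∈ T, thinCosetTestFun K ι (φ t) t 𝔫 v) =
      ∑ t ∈ T, thinCosetTestFun K ι (φ t) t 𝔫 := by
    funext v
    simp [Finset.sum_apply]
  rw [h]
  exact Submodule.sum_mem _ fun t _ => thinCosetTestFun_mem_piSchwartzBruhat (φ t) t 𝔫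

variable {K ι}

/-- Value of `Σ_t φ_t ⊗ 𝟙_{t + (𝔫𝒪̂)^ι}` ON the coset of `t₀ ∈ T` (pairwise inequivalent
representatives): `φ_{t₀}(v_∞)`. [cite: Weil1964, n° 11 p. 158] -/
theorem sum_thinCosetTestFun_apply_of_mem {T : Finset (ι → FiniteAdeleRing (𝓞 K) K)}
    {𝔫 : Ideal (𝓞 K)}
    (hT : ∀ t ∈ T, ∀ t' ∈ T, t ≠ t' → -t + t' ∉ piLevelIdeal K ι 𝔫)
    (φ : (ι → FiniteAdeleRing (𝓞 K) K) → 𝓢((ι → mixedSpace K), ℂ)) {t₀ : ι → FiniteAdeleRing (𝓞 K) K}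
    (ht₀ : t₀ ∈ T) {v : ι → AdeleRing (𝓞 K) K} (hv : -t₀ + piFinite K ι v ∈ piLevelIdeal K ι 𝔫) :
    ∑ t ∈ T, thinCosetTestFun K ι (φ t) t 𝔫 v = φ t₀ (piArch K ι v) := by
  rw [Finset.sum_eq_single t₀, thinCosetTestFun_of_mem (φ t₀) t₀ 𝔫 hv]
  · intro t ht hne
    refine thinCosetTestFun_of_not_mem (φ t) t 𝔫 fun h => ?_
    exact hT t ht t₀ ht₀ hne
      (QuotientAddGroup.eq.1 ((QuotientAddGroup.eq.2 h).trans (QuotientAddGroup.eq.2 hv).symm))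
  · exact fun h => (h ht₀).elim

/-- Value of `Σ_t φ_t ⊗ 𝟙_{t + (𝔫𝒪̂)^ι}` OFF all the cosets: `0`. [cite: Weil1964, n° 11 p. 158] -/
theorem sum_thinCosetTestFun_apply_of_forall_not_mem {T : Finset (ι → FiniteAdeleRing (𝓞 K) K)}
    {𝔫 : Ideal (𝓞 K)} (φ : (ι → FiniteAdeleRing (𝓞 K) K) → 𝓢((ι → mixedSpace K), ℂ))
    {v : ι → AdeleRing (𝓞 K) K} (hv : ∀ t ∈ T, -t + piFinite K ι v ∉ piLevelIdeal K ι 𝔫) :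
    ∑ t ∈ T, thinCosetTestFun K ι (φ t) t 𝔫 v = 0 :=
  Finset.sum_eq_zero fun t ht => thinCosetTestFun_of_not_mem (φ t) t 𝔫 (hv t ht)

variable (K ι)

omit [Fintype ι] in
/-- The **box** `{v | v_∞ ∈ C, -t + v_f ∈ (𝔫𝒪̂)^ι}` of `𝔸_K^ι` over an archimedean set `C` and the
thin coset of `t`. [folklore] -/
private theorem archFinBox_eq_image (C : Set (ι → mixedSpace K)) (t : ι → FiniteAdeleRing (𝓞 K) K)
    (𝔫 : Ideal (𝓞 K)) :
    {v : ι → AdeleRing (𝓞 K) K | piArch K ι v ∈ C ∧ -t + piFinite K ι v ∈ piLevelIdeal K ι 𝔫} =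
      piAdeleSplit K ι ''
        (C ×ˢ (t +ᵥ (piLevelIdeal K ι 𝔫 : Set (ι → FiniteAdeleRing (𝓞 K) K)))) := by
  ext v
  constructor
  · rintro ⟨hC, ht⟩
    refine ⟨(piArch K ι v, piFinite K ι v), ⟨hC, Set.mem_vadd_set_iff_neg_vadd_mem.2 ht⟩, ?_⟩
    exact (piAdeleSplit K ι).apply_symm_apply v
  · rintro ⟨⟨a, b⟩, ⟨ha, hb⟩, rfl⟩
    refine ⟨by simpa using ha, ?_⟩
    simpa using Set.mem_vadd_set_iff_neg_vadd_mem.1 hb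

/-- The box over a compact archimedean set is compact (image of `C × (t + (𝔫𝒪̂)^ι)` under the
splitting homeomorphism; the level box is compact, `isCompact_piLevelIdeal`). [cite: Weil1964, n° 11 p. 158] -/
theorem isCompact_archFinBox {C : Set (ι → mixedSpace K)} (hC : IsCompact C)
    (t : ι → FiniteAdeleRing (𝓞 K) K) (𝔫 : Ideal (𝓞 K)) :
    IsCompact {v : ι → AdeleRing (𝓞 K) K |
      piArch K ι v ∈ C ∧ -t + piFinite K ι v ∈ piLevelIdeal K ι 𝔫} := by
  rw [archFinBox_eq_image]
  refine (hC.prod ?_).image (piAdeleSplit K ι).continuous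
  exact (isOpen_isClosed_isCompact_vadd_addSubgroup _ (isOpen_piLevelIdeal K 𝔫)
    (isCompact_piLevelIdeal K ι 𝔫) t).2.2

/-- The box over a closed archimedean set is closed. [cite: Weil1964, n° 11 p. 158] -/
theorem isClosed_archFinBox {C : Set (ι → mixedSpace K)} (hC : IsClosed C)
    (t : ι → FiniteAdeleRing (𝓞 K) K) (𝔫 : Ideal (𝓞 K)) :
    IsClosed {v : ι → AdeleRing (𝓞 K) K |
      piArch K ι v ∈ C ∧ -t + piFinite K ι v ∈ piLevelIdeal K ι 𝔫} := by
  have h : {v : ι → AdeleRing (𝓞 K) K | piArch K ι v ∈ C ∧ -t + piFinite K ι v ∈ piLevelIdeal K ι 𝔫} =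
      piArch K ι ⁻¹' C ∩
        piFinite K ι ⁻¹' (t +ᵥ (piLevelIdeal K ι 𝔫 : Set (ι → FiniteAdeleRing (𝓞 K) K))) := by
    ext v
    simp [Set.mem_vadd_set_iff_neg_vadd_mem]
  rw [h]
  exact (hC.preimage continuous_piArch).inter
    ((isOpen_isClosed_isCompact_vadd_addSubgroup _ (isOpen_piLevelIdeal K 𝔫)
      (isCompact_piLevelIdeal K ι 𝔫) t).2.1.preimage continuous_piFinite)

/-- **Support of `Σ_t φ_t ⊗ 𝟙_{t + (𝔫𝒪̂)^ι}`**: inside the finite union of the boxes over the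
supports `tsupport φ_t`. [cite: Weil1964, n° 11 p. 158] -/
theorem tsupport_sum_thinCosetTestFun_subset (T : Finset (ι → FiniteAdeleRing (𝓞 K) K))
    (φ : (ι → FiniteAdeleRing (𝓞 K) K) → 𝓢((ι → mixedSpace K), ℂ)) (𝔫 : Ideal (𝓞 K)) :
    tsupport (fun v => ∑ t ∈ T, thinCosetTestFun K ι (φ t) t 𝔫 v) ⊆
      ⋃ t ∈ T, {v : ι → AdeleRing (𝓞 K) K |
        piArch K ι v ∈ tsupport (φ t : (ι → mixedSpace K) → ℂ) ∧
          -t + piFinite K ι v ∈ piLevelIdeal K ι 𝔫} := by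
  refine closure_minimal (fun v hv => ?_)
    (isClosed_biUnion_finset fun t _ => isClosed_archFinBox K ι isClosed_closure t 𝔫)
  obtain ⟨t, ht, hne⟩ := Finset.exists_ne_zero_of_sum_ne_zero hv
  refine Set.mem_iUnion₂.2 ⟨t, ht, ?_⟩
  by_cases hmem : -t + piFinite K ι v ∈ piLevelIdeal K ι 𝔫
  · rw [thinCosetTestFun_of_mem (φ t) t 𝔫 hmem] at hne
    exact ⟨subset_closure hne, hmem⟩
  · exact (hne (thinCosetTestFun_of_not_mem (φ t) t 𝔫 hmem)).elim

/-- `Σ_t φ_t ⊗ 𝟙_{t + (𝔫𝒪̂)^ι}` has compact support when every `φ_t` has. [cite: Weil1964, n° 11 p. 158] -/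
theorem hasCompactSupport_sum_thinCosetTestFun (T : Finset (ι → FiniteAdeleRing (𝓞 K) K))
    {φ : (ι → FiniteAdeleRing (𝓞 K) K) → 𝓢((ι → mixedSpace K), ℂ)}
    (hφ : ∀ t ∈ T, HasCompactSupport (φ t : (ι → mixedSpace K) → ℂ)) (𝔫 : Ideal (𝓞 K)) :
    HasCompactSupport (fun v => ∑ t ∈ T, thinCosetTestFun K ι (φ t) t 𝔫 v) :=
  IsCompact.of_isClosed_subset (T.isCompact_biUnion fun t ht => isCompact_archFinBox K ι (hφ t ht) t 𝔫)
    isClosed_closure (tsupport_sum_thinCosetTestFun_subset K ι T φ 𝔫)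

end Sums

end Literature.NumberTheory.Automorphic
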